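import Literature.NumberTheory.Transcendental.Hyperlogarithms
import Literature.NumberTheory.Transcendental.DrinfeldAssociatorHexagonProofs
import HarnessLib

/-!
# Hyperlogarithms on `(0,1)`, II: shuffle regularisation at the base point `0` (all words)

Second layer of the analytic road to `GenusZeroPeriodsMZV` (see `Hyperlogarithms.lean`): the
extension of the hyperlogarithms `L_w(b)` of a real alphabet `{0} ∪ [1,∞)` from the words regular at
`0` (not ending with the letter `z` at `0`) to ALL words, following [Brown 2009, §5.1 after (5.5)]:
"any word can be uniquely written as a linear combination of shuffles of `a₀ⁿ` with words in `A*_c`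
… we set `L_{a₀}(z) = log(z - σ₀)` and extend the definition of `L_w(z)` to all words by demanding
the shuffle relations", equivalently [Brown 2009, Prop. 5.1] the generating series factorises as
`L(z) = f₀(z) exp(a₀ log(z - σ₀))` with `f₀` holomorphic at `σ₀`, `f₀(σ₀) = 1`. Everything is PROVED;
no named fact is introduced.

In the positive normalisation of `Hyperlogarithms.lean` (`Hyperlog.pden`, `Hyperlog.hlog`) and the
coefficientwise series language of the tree (`NCSeries`, `transportSeries`, IKZ's end regularisation
`Shuffle.regEnd` of `DrinfeldAssociatorRegularisation.lean`, `Shuffle.expLetter`):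

* `Hyperlog.hlogReg σ z W b = ⟨L(b), regEnd_z W⟩` — the coefficients of Brown's `f₀(b)`; equal to
  `L_W(b)` for `W` regular (`hlogReg_eq_hlog`), `0` on `z^{k+1}`, `→ δ_{W,∅}` as `b → 0⁺`
  (`tendsto_hlogReg_zero`, i.e. `f₀(0) = 1`).
* `Hyperlog.hlogSeries σ z b = f₀(b) · exp(z log b)` — the full series `L(b)`, `b ∈ (0,1)`:
  `L(b)_{zⁿ} = logⁿ(b)/n!` (`hlogSeries_replicate`), `L(b)_W = L_W(b)` for regular `W`.
* PROVED: the EXACT factorisation of the honest transport `S_{ε,b}` of `Σ_c c dt/|t - σ_c|` over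
  `[ε,b] ⊂ (0,1)`: `S_{ε,b} = R_ε exp(z log(b/ε))`, `R_ε = ⟨S_{ε,b}, regEnd_z ·⟩`
  (`iterInt_eq_pair_regEnd_mul_expLetter`, from `Shuffle.mul_expLetter_eq_pair_regEnd`); the limit
  `R_ε → f₀(b)` with rate `O(|log ε|^{|W|} ε)` (`abs_pair_regEnd_sub_hlogReg_le`); hence the
  regularised asymptotics `I_W(ε,b) = Σ_{W=Uzⁿ} f₀(b)_U logⁿ(b/ε)/n! + o(1)`
  (`tendsto_iterInt_sub_expansion`) and `S_{ε,b} exp(z log ε) → L(b)` (`tendsto_transport_mul_expLetter`);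
  `L(b)` is GROUP-LIKE — the shuffle relations for all words, [Brown 2009, (5.5)] extended —
  (`isGroupLike_hlogSeries`, `hlogSeries_mul`); the flat-section property
  `L(b') = S_{b→b'} L(b)` (`hlogSeries_chen`); the differential equation (5.2) for ALL words and
  letters `∂_b L(b)_{cW} = L(b)_W/|b - σ_c|` (`hasDerivAt_hlogSeries_cons`), continuity, and the
  integral formula between interior points (`hlogSeries_cons_sub`).

## References

* F. C. S. Brown, *Multiple zeta values and periods of moduli spaces `𝔐̄_{0,n}`*, Ann. Sci. Éc.
  Norm. Supér. (4) 42 (2009), 371–489, §5.1 (pp. 439–440: (5.2), Prop. 5.1, (5.4), (5.5) and the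
  paragraph following it). doi:10.24033/asens.2099. [BrownENS2009]
* K. Ihara, M. Kaneko, D. Zagier, *Derivation and double shuffle relations for multiple zeta
  values*, Compos. Math. 142 (2006), §3, Cor. 5 (the regularisation `reg`). [IharaKanekoZagier2006]
-/

noncomputable section

open MeasureTheory intervalIntegral Set Filter
open scoped BigOperators Topology

namespace Literature.NumberTheory.Transcendental

namespace Hyperlog

variable {α : Type*} (σ : α → ℝ)

/-! ### Shuffle regularisation at the tangential base point `0`: all words

Fix the letter `z` at `0` (all other letters in `[1,∞)`). Following [Brown 2009, §5.1 (after
(5.5)) and Prop. 5.1] every word is uniquely a combination of shuffles `v ш zⁿ` with `v` not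
ending in `z`, `L_{z} = log`, and the generating series of hyperlogarithms factorises as
`L(b) = f₀(b) · exp(z log b)` with `f₀(b) → 1` as `b → 0⁺`; coefficientwise `f₀(b)_W = ⟨L(b), regEnd_z W⟩`
(IKZ's end regularisation, `Shuffle.regEnd`). We DEFINE `f₀` this way from the regular words
(`hlogReg`) and `L(b) := f₀(b) exp(z log b)` (`hlogSeries`), and prove that this is the
`ε → 0⁺` asymptotics of the honest transport `S_{ε,b}` of `Σ_c c dt/|t-σ_c|`:
`S_{ε,b} = R_ε · exp(z log(b/ε))` EXACTLY (`iterInt_eq_pair_regEnd_mul_expLetter`), `R_ε → f₀(b)`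
with rate, hence `I_W(ε,b) = Σ_{W = U zⁿ} f₀(b)_U logⁿ(b/ε)/n! + o(1)` and
`S_{ε,b} exp(z log ε) → L(b)`; in particular `L(b)` is group-like (shuffle relations for ALL
words, [Brown 2009, (5.5) extended]). -/

section Regularised

variable [DecidableEq α]

omit [DecidableEq α] in
/-- An alphabet with one letter `z` at `0` and all others in `[1,∞)` is admissible. [folklore] -/
theorem adm_of_zero_letter {z : α} (hz : σ z = 0) (hσz : ∀ c, c ≠ z → 1 ≤ σ c) :
    ∀ c, σ c = 0 ∨ 1 ≤ σ c := fun c => by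
  by_cases hc : c = z
  · exact Or.inl (hc ▸ hz)
  · exact Or.inr (hσz c hc)

omit [DecidableEq α] in
/-- In such an alphabet the letter at `0` is `z`. [folklore] -/
theorem eq_zero_letter_iff {z : α} (hz : σ z = 0) (hσz : ∀ c, c ≠ z → 1 ≤ σ c) {c : α} :
    σ c = 0 ↔ c = z := by
  constructor
  · intro h; by_contra hc; have := hσz c hc; linarith
  · intro h; rw [h, hz]

omit [DecidableEq α] in
/-- Regular words are the words not ending with `z`. [folklore] -/
theorem isReg_iff_getLast?_ne {z : α} (hz : σ z = 0) (hσz : ∀ c, c ≠ z → 1 ≤ σ c) {w : List α} :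
    IsReg σ w ↔ w.getLast? ≠ some z := by
  by_cases hw : w = []
  · subst hw; simp [IsReg]
  · rw [List.getLast?_eq_some_getLast hw]
    simp only [ne_eq, Option.some.injEq]
    constructor
    · intro h heq; exact h hw ((eq_zero_letter_iff σ hz hσz).2 heq)
    · intro h h'
      rw [Ne, eq_zero_letter_iff σ hz hσz]
      exact h

/-- `regFront_y w = w` for a word not starting with `y`. [cite: IharaKanekoZagier2006, Cor. 5] -/
theorem regFront_eq_single_of_head?_ne {y : α} {w : List α} (h : w.head? ≠ some y) :
    Shuffle.regFront y w = Finsupp.single w 1 := by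
  have h0 : Shuffle.leadCount y w = 0 := by
    cases w with
    | nil => rfl
    | cons c w => exact Shuffle.leadCount_cons_of_ne (fun hc => h (by rw [hc]; rfl)) w
  rw [Shuffle.regFront, h0]
  simp

/-- `regEnd_x w = w` for a word not ending with `x`. [cite: IharaKanekoZagier2006, Cor. 5] -/
theorem regEnd_eq_single_of_getLast?_ne {x : α} {w : List α} (h : w.getLast? ≠ some x) :
    Shuffle.regEnd x w = Finsupp.single w 1 := by
  rw [Shuffle.regEnd, regFront_eq_single_of_head?_ne (by rwa [List.head?_reverse]),
    Finsupp.mapDomain_single, List.reverse_reverse]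

/-- `regFront_y (y^{k+1}) = 0`. [cite: IharaKanekoZagier2006, Cor. 5] -/
theorem regFront_replicate_succ (y : α) (k : ℕ) :
    Shuffle.regFront y (List.replicate (k + 1) y) = 0 := by
  by_contra hne
  obtain ⟨u, hu⟩ := Finsupp.support_nonempty_iff.mpr hne
  have hcount := Shuffle.count_eq_of_mem_support_regFront y _ hu
  have hlen : u.length = k + 1 := by
    rw [Shuffle.length_eq_of_count_eq hcount, List.length_replicate]
  have hu' : u = List.replicate (k + 1) y := by
    rw [List.eq_replicate_iff]
    refine ⟨hlen, fun b hb => ?_⟩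
    by_contra hby
    have h1 := List.count_pos_iff.mpr hb
    rw [hcount, List.count_replicate] at h1
    have hyb : ¬ ((y == b) = true) := by simpa using fun h => hby h.symm
    rw [if_neg hyb] at h1
    exact lt_irrefl 0 h1
  rw [hu', List.replicate_succ] at hu
  exact (Finsupp.mem_support_iff.mp hu) (Shuffle.regFront_apply_cons_self y _ _)

/-- `regEnd_x (x^{k+1}) = 0`. [cite: IharaKanekoZagier2006, Cor. 5] -/
theorem regEnd_replicate_succ (x : α) (k : ℕ) :
    Shuffle.regEnd x (List.replicate (k + 1) x) = 0 := by
  rw [Shuffle.regEnd, List.reverse_replicate, regFront_replicate_succ, Finsupp.mapDomain_zero]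

/-- Words in the support of `regEnd_x W` have the length of `W`. [folklore] -/
theorem length_eq_of_mem_support_regEnd (x : α) (W : List α) {u : List α}
    (hu : u ∈ (Shuffle.regEnd x W).support) : u.length = W.length :=
  Shuffle.length_eq_of_count_eq (Shuffle.count_eq_of_mem_support_regEnd x W hu)

/-- **The regularised hyperlogarithm** `L^reg_W(b) = ⟨L(b), regEnd_z W⟩ = Σ_u (regEnd_z W)_u L_u(b)`,
the coefficient of `W` in Brown's holomorphic factor `f₀(b)` of `L(b) = f₀(b) exp(z log b)`
[Brown 2009, Prop. 5.1; §5.1 after (5.5)], written with IKZ's end regularisation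
[IharaKanekoZagier2006, Cor. 5]. It equals `L_W(b)` for `W` not ending in `z`
(`hlogReg_eq_hlog`). [cite: BrownENS2009, §5.1 Prop. 5.1] -/
def hlogReg (σ : α → ℝ) (z : α) (W : List α) (b : ℝ) : ℝ :=
  Shuffle.pair (fun u => hlog σ u b) (Shuffle.regEnd z W)

/-- **The generating series of hyperlogarithms** `L(b) = f₀(b) · exp(z log b)` (positive
normalisation, `b ∈ (0,1)`): its coefficients `L(b)_W = Σ_{W = U zⁿ} L^reg_U(b) logⁿ(b)/n!` extend
`L_W(b)` to ALL words with `L_{zⁿ}(b) = logⁿ(b)/n!` [Brown 2009, §5.1: "`L_{a₀}(z) = log(z - σ₀)`,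
and extend the definition of `L_w(z)` to all words by demanding the shuffle relations"].
[cite: BrownENS2009, §5.1 Prop. 5.1] -/
def hlogSeries (σ : α → ℝ) (z : α) (b : ℝ) : NCSeries α ℝ :=
  (show NCSeries α ℝ from fun W => hlogReg σ z W b) * Shuffle.expLetter z (Real.log b)

variable {σ} {z : α} (hz : σ z = 0) (hσz : ∀ c, c ≠ z → 1 ≤ σ c)
include hz hσz

/-- `L^reg_W = L_W` for `W` regular at `0`. [folklore] -/
theorem hlogReg_eq_hlog {W : List α} (hW : IsReg σ W) (b : ℝ) : hlogReg σ z W b = hlog σ W b := by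
  rw [hlogReg, regEnd_eq_single_of_getLast?_ne ((isReg_iff_getLast?_ne σ hz hσz).1 hW),
    Shuffle.pair_single, one_smul]

omit hz hσz in
/-- `L^reg_∅ = 1` on `(0,1)`. [folklore] -/
theorem hlogReg_nil (hσ : ∀ c, σ c = 0 ∨ 1 ≤ σ c) {b : ℝ} (hb : b ∈ Ioo (0 : ℝ) 1) :
    hlogReg σ z [] b = 1 := by
  rw [hlogReg, regEnd_eq_single_of_getLast?_ne (by simp), Shuffle.pair_single, one_smul, hlog_nil hσ hb]

omit hz hσz in
/-- `L^reg_{z^{k+1}} = 0`. [folklore] -/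
theorem hlogReg_replicate_succ (k : ℕ) (b : ℝ) : hlogReg σ z (List.replicate (k + 1) z) b = 0 := by
  rw [hlogReg, regEnd_replicate_succ, Shuffle.pair_zero]

/-- Words in the support of `regEnd_z W` are regular at `0`. [folklore] -/
theorem isReg_of_mem_support_regEnd (W : List α) {u : List α}
    (hu : u ∈ (Shuffle.regEnd z W).support) : IsReg σ u :=
  (isReg_iff_getLast?_ne σ hz hσz).2 (Shuffle.getLast?_ne_of_mem_support_regEnd z W hu)

omit [DecidableEq α] hσz in
/-- The transport series sees the letter at `0` as `log(b/ε)`. [folklore] -/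
theorem transportSeries_pden_zero_letter {ε b : ℝ} (hε : 0 < ε) (hb : 0 < b) :
    transportSeries (pden σ) ε b [z] = Real.log b - Real.log ε := by
  rw [transportSeries_apply, iterInt_cons]
  simp only [iterInt_nil, mul_one]
  have h : ∫ t in ε..b, pden σ z t = ∫ t in ε..b, t⁻¹ := by
    refine integral_congr fun t ht => ?_
    have ht0 : 0 < t := by
      rcases le_total ε b with h | h
      · rw [uIcc_of_le h] at ht; exact hε.trans_le ht.1
      · rw [uIcc_of_ge h] at ht; exact hb.trans_le ht.1
    rw [pden, hz, sub_zero, abs_of_pos ht0, one_div]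
  rw [h, integral_inv_of_pos hε hb, Real.log_div hb.ne' hε.ne']

/-- **Exact factorisation of the transport**: `I_W(ε,b) = (R_ε · exp(z log(b/ε)))_W` with
`R_ε = (U ↦ ⟨S_{ε,b}, regEnd_z U⟩)` (the end factorisation of the group-like transport series,
`Shuffle.mul_expLetter_eq_pair_regEnd`). [cite: IharaKanekoZagier2006, Cor. 5] -/
theorem iterInt_eq_pair_regEnd_mul_expLetter (W : List α) {ε b : ℝ} (hε : ε ∈ Ioo (0 : ℝ) 1)
    (hb : b ∈ Ioo (0 : ℝ) 1) :
    iterInt (pden σ) W ε b =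
      ((show NCSeries α ℝ from
          fun U => Shuffle.pair (fun u => iterInt (pden σ) u ε b) (Shuffle.regEnd z U)) *
        Shuffle.expLetter z (Real.log b - Real.log ε)) W := by
  have hS := isGroupLike_transportSeries KZ3.isOpen_Ioo01 KZ3.ordConnected_Ioo01
    (continuousOn_pden (adm_of_zero_letter σ hz hσz)) hε hb
  have hfac : (show NCSeries α ℝ from
      fun U => Shuffle.pair (fun u => iterInt (pden σ) u ε b) (Shuffle.regEnd z U)) =
      transportSeries (pden σ) ε b * Shuffle.expLetter z (-(Real.log b - Real.log ε)) := by
    funext U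
    rw [← transportSeries_pden_zero_letter hz hε.1 hb.1]
    exact (Shuffle.mul_expLetter_eq_pair_regEnd hS z U).symm
  rw [hfac, mul_assoc, Shuffle.expLetter_neg_mul_expLetter, mul_one, transportSeries_apply]

/-- `R_ε(W) → L^reg_W(b)` as `ε → 0⁺`. [folklore] -/
theorem tendsto_pair_regEnd (W : List α) {b : ℝ} (hb : b ∈ Ioo (0 : ℝ) 1) :
    Tendsto (fun ε => Shuffle.pair (fun u => iterInt (pden σ) u ε b) (Shuffle.regEnd z W))
      (𝓝[>] 0) (𝓝 (hlogReg σ z W b)) := by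
  unfold hlogReg Shuffle.pair Finsupp.sum
  refine tendsto_finsetSum _ fun u hu => ?_
  exact (tendsto_hlog (adm_of_zero_letter σ hz hσz) (isReg_of_mem_support_regEnd hz hσz W hu)
    hb).const_smul _

/-- The `ℓ¹`-norm of `regEnd_z W` (a constant depending on the word only). [folklore] -/
def regEndNorm (z : α) (W : List α) : ℝ := (Shuffle.regEnd z W).sum fun _ a => |(a : ℝ)|

omit hz hσz in
/-- `0 ≤ ‖regEnd_z W‖₁`. [folklore] -/
theorem regEndNorm_nonneg (W : List α) : 0 ≤ regEndNorm z W :=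
  Finset.sum_nonneg fun _ _ => abs_nonneg _

/-- **Rate**: `|R_ε(W) - L^reg_W(b)| ≤ ‖regEnd_z W‖₁ (|W|+1)(|log ε|+|log(1-b)|+1)^{|W|} 4^{|W|} ε`
for `0 < ε ≤ 1/2`, `ε < b < 1`. [folklore] -/
theorem abs_pair_regEnd_sub_hlogReg_le (W : List α) {ε b : ℝ} (hε0 : 0 < ε) (hε : ε ≤ 1 / 2)
    (hεb : ε < b) (hb : b < 1) :
    |Shuffle.pair (fun u => iterInt (pden σ) u ε b) (Shuffle.regEnd z W) - hlogReg σ z W b| ≤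
      regEndNorm z W * ((W.length + 1) *
        ((|Real.log ε| + |Real.log (1 - b)| + 1) ^ W.length * 4 ^ W.length * ε)) := by
  rw [hlogReg, Shuffle.pair_sub]
  refine Shuffle.abs_pair_le fun u hu => ?_
  have hreg := isReg_of_mem_support_regEnd hz hσz W hu
  have hlen := length_eq_of_mem_support_regEnd z W hu
  rw [abs_sub_comm, abs_of_nonneg (sub_nonneg_hlog (adm_of_zero_letter σ hz hσz) hreg
    ⟨hε0.trans hεb, hb⟩ ⟨hε0, hεb⟩), ← hlen]
  exact hlog_sub_le (adm_of_zero_letter σ hz hσz) hreg hε0 hε hεb hb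

omit [DecidableEq α] hz hσz in
/-- `(|log ε| + A)^N ε → 0` as `ε → 0⁺`. [folklore] -/
theorem tendsto_pow_log_mul_self (A : ℝ) (N : ℕ) :
    Tendsto (fun ε : ℝ => (|Real.log ε| + A) ^ N * ε) (𝓝[>] 0) (𝓝 0) := by
  -- `s = -log ε → +∞`, and `(s + A)^N e^{-s} = e^{A} (s+A)^N e^{-(s+A)} → 0`
  have h1 : Tendsto (fun s : ℝ => (s + A) ^ N * Real.exp (-(s + A))) atTop (𝓝 0) :=
    (Real.tendsto_pow_mul_exp_neg_atTop_nhds_zero N).comp (tendsto_atTop_add_const_right _ _ tendsto_id)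
  have h2 : Tendsto (fun s : ℝ => Real.exp A * ((s + A) ^ N * Real.exp (-(s + A)))) atTop (𝓝 0) := by
    simpa using h1.const_mul (Real.exp A)
  have h3 : Tendsto (fun ε : ℝ => -Real.log ε) (𝓝[>] 0) atTop :=
    tendsto_neg_atBot_atTop.comp Real.tendsto_log_nhdsGT_zero
  refine ((h2.comp h3).congr' ?_)
  filter_upwards [Ioo_mem_nhdsGT (zero_lt_one' ℝ)] with ε hε
  have hlog : Real.log ε < 0 := Real.log_neg hε.1 hε.2
  simp only [Function.comp_def]
  rw [abs_of_neg hlog, show -(-Real.log ε + A) = Real.log ε - A by ring, Real.exp_sub,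
    Real.exp_log hε.1]
  field_simp

/-- **The regularised asymptotics at the base point**:
`I_W(ε,b) - Σ_{W = U zⁿ} L^reg_U(b) logⁿ(b/ε)/n! → 0` as `ε → 0⁺` — the divergent iterated integral
from `ε` is, up to `o(1)`, the polynomial in `log ε` read off from `L(b) = f₀(b) exp(z log b)`
[Brown 2009, Prop. 5.1: `L(z) ∼ (z - σ₀)^{a₀}`]. [cite: BrownENS2009, §5.1 Prop. 5.1] -/
theorem tendsto_iterInt_sub_expansion (W : List α) {b : ℝ} (hb : b ∈ Ioo (0 : ℝ) 1) :
    Tendsto (fun ε => iterInt (pden σ) W ε b -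
      ((show NCSeries α ℝ from fun U => hlogReg σ z U b) *
        Shuffle.expLetter z (Real.log b - Real.log ε)) W)
      (𝓝[>] 0) (𝓝 0) := by
  classical
  -- rewrite the difference as `((R_ε - R_0) · E_ε)_W`, a finite sum over the splittings of `W`
  have heq : ∀ ε ∈ Ioo (0 : ℝ) b, iterInt (pden σ) W ε b -
      ((show NCSeries α ℝ from fun U => hlogReg σ z U b) *
        Shuffle.expLetter z (Real.log b - Real.log ε)) W =
      ∑ p ∈ NCSeries.splits W,
        (Shuffle.pair (fun u => iterInt (pden σ) u ε b) (Shuffle.regEnd z p.1) - hlogReg σ z p.1 b) *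
          Shuffle.expLetter z (Real.log b - Real.log ε) p.2 := by
    intro ε hε
    rw [iterInt_eq_pair_regEnd_mul_expLetter hz hσz W ⟨hε.1, hε.2.trans hb.2⟩ hb,
      NCSeries.mul_apply, NCSeries.mul_apply, ← Finset.sum_sub_distrib]
    refine Finset.sum_congr rfl fun p _ => ?_
    ring
  have hterm : ∀ p ∈ NCSeries.splits W, Tendsto (fun ε =>
      (Shuffle.pair (fun u => iterInt (pden σ) u ε b) (Shuffle.regEnd z p.1) - hlogReg σ z p.1 b) *
        Shuffle.expLetter z (Real.log b - Real.log ε) p.2) (𝓝[>] 0) (𝓝 0) := by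
    intro p _
    -- each term is `O((|log ε| + A)^{|W|} ε)`
    set A : ℝ := |Real.log (1 - b)| + |Real.log b| + 1 with hA
    have hA0 : 0 ≤ A := by positivity
    set C : ℝ := regEndNorm z p.1 * (p.1.length + 1) * 4 ^ p.1.length with hC
    have hreg0 := regEndNorm_nonneg (z := z) p.1
    have hC0 : 0 ≤ C := by positivity
    have hbound : ∀ᶠ ε in 𝓝[>] (0 : ℝ),
        |(Shuffle.pair (fun u => iterInt (pden σ) u ε b) (Shuffle.regEnd z p.1) - hlogReg σ z p.1 b) *
          Shuffle.expLetter z (Real.log b - Real.log ε) p.2| ≤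
          C * ((|Real.log ε| + A) ^ (p.1.length + p.2.length) * ε) := by
      filter_upwards [Ioo_mem_nhdsGT (lt_min (by norm_num : (0 : ℝ) < 1 / 2) hb.1)] with ε hε
      have hε2 : ε ≤ 1 / 2 := (hε.2.trans_le (min_le_left _ _)).le
      have hεb : ε < b := hε.2.trans_le (min_le_right _ _)
      rw [abs_mul]
      have h1 := abs_pair_regEnd_sub_hlogReg_le hz hσz p.1 hε.1 hε2 hεb hb.2
      have h2 : |Shuffle.expLetter z (Real.log b - Real.log ε) p.2| ≤
          (|Real.log ε| + A) ^ p.2.length := by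
        unfold Shuffle.expLetter
        split_ifs with h
        · rw [abs_mul, abs_pow]
          have hf1 : (1 : ℝ) ≤ p.2.length.factorial := by
            exact_mod_cast Nat.one_le_iff_ne_zero.mpr (Nat.factorial_ne_zero _)
          have hfac : |algebraMap ℚ ℝ (1 / (p.2.length.factorial : ℚ))| ≤ 1 := by
            rw [eq_ratCast, Rat.cast_div, Rat.cast_one, Rat.cast_natCast,
              abs_of_nonneg (by positivity)]
            exact div_le_one_of_le₀ hf1 (by positivity)
          calc |algebraMap ℚ ℝ (1 / (p.2.length.factorial : ℚ))| *
                |Real.log b - Real.log ε| ^ p.2.length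
              ≤ 1 * (|Real.log ε| + A) ^ p.2.length := by
                refine mul_le_mul hfac (pow_le_pow_left₀ (abs_nonneg _) ?_ _) (by positivity)
                  zero_le_one
                calc |Real.log b - Real.log ε| ≤ |Real.log b| + |Real.log ε| := abs_sub _ _
                  _ ≤ |Real.log ε| + A := by rw [hA]; linarith [abs_nonneg (Real.log (1 - b))]
            _ = _ := one_mul _
        · rw [abs_zero]; positivity
      calc |Shuffle.pair (fun u => iterInt (pden σ) u ε b) (Shuffle.regEnd z p.1) - hlogReg σ z p.1 b| *
            |Shuffle.expLetter z (Real.log b - Real.log ε) p.2|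
          ≤ regEndNorm z p.1 * ((p.1.length + 1) *
              ((|Real.log ε| + |Real.log (1 - b)| + 1) ^ p.1.length * 4 ^ p.1.length * ε)) *
              (|Real.log ε| + A) ^ p.2.length :=
            mul_le_mul h1 h2 (abs_nonneg _) (by have := hε.1.le; positivity)
        _ ≤ regEndNorm z p.1 * ((p.1.length + 1) *
              ((|Real.log ε| + A) ^ p.1.length * 4 ^ p.1.length * ε)) *
              (|Real.log ε| + A) ^ p.2.length := by
            have hε0 := hε.1.le
            have hlogle : |Real.log ε| + |Real.log (1 - b)| + 1 ≤ |Real.log ε| + A := by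
              rw [hA]; linarith [abs_nonneg (Real.log b)]
            gcongr
        _ = C * ((|Real.log ε| + A) ^ (p.1.length + p.2.length) * ε) := by
            rw [hC, pow_add]; ring
    refine squeeze_zero_norm' (by simpa only [Real.norm_eq_abs] using hbound) ?_
    simpa using (tendsto_pow_log_mul_self A (p.1.length + p.2.length)).const_mul C
  have hlim : Tendsto (fun ε => ∑ p ∈ NCSeries.splits W,
      (Shuffle.pair (fun u => iterInt (pden σ) u ε b) (Shuffle.regEnd z p.1) - hlogReg σ z p.1 b) *
        Shuffle.expLetter z (Real.log b - Real.log ε) p.2) (𝓝[>] 0) (𝓝 0) := by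
    simpa using tendsto_finsetSum _ hterm
  refine hlim.congr' ?_
  filter_upwards [Ioo_mem_nhdsGT hb.1] with ε hε
  exact (heq ε hε).symm

/-- `L(b)_W = L_W(b)` for a word regular at `0` (no `zⁿ`-tail). [folklore] -/
theorem hlogSeries_apply_of_isReg {W : List α} (hW : IsReg σ W) (b : ℝ) :
    hlogSeries σ z b W = hlog σ W b := by
  classical
  rw [hlogSeries, NCSeries.mul_apply, ← Finset.add_sum_erase _ _ (NCSeries.self_nil_mem_splits W)]
  simp only [Shuffle.expLetter_nil, mul_one]
  rw [hlogReg_eq_hlog hz hσz hW, Finset.sum_eq_zero, add_zero]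
  intro p hp
  obtain ⟨hne, hp⟩ := Finset.mem_erase.mp hp
  rw [NCSeries.mem_splits] at hp
  have hp2 : p.2 ≠ [] := by
    intro h2; apply hne; ext1
    · simpa [h2] using hp
    · exact h2
  -- `p.2` is a nonempty suffix of a regular word: it does not end in `z`, so it is not a power of `z`
  have hreg2 : IsReg σ p.2 := hW.suffix σ p.1 p.2 hp
  have hnot : p.2 ≠ List.replicate p.2.length z := by
    intro h
    have hl : p.2.getLast hp2 = z :=
      List.eq_of_mem_replicate (h ▸ List.getLast_mem hp2 : p.2.getLast hp2 ∈ List.replicate p.2.length z)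
    exact hreg2 hp2 (by rw [hl, hz])
  rw [Shuffle.expLetter_apply_of_ne z _ hnot, mul_zero]

omit hz hσz in
/-- `L(b)_{zⁿ} = logⁿ(b)/n!` (`L_{a₀} = log`, [Brown 2009, §5.1]). [cite: BrownENS2009, §5.1] -/
theorem hlogSeries_replicate (hσ : ∀ c, σ c = 0 ∨ 1 ≤ σ c) (n : ℕ) {b : ℝ} (hb : b ∈ Ioo (0 : ℝ) 1) :
    hlogSeries σ z b (List.replicate n z) =
      algebraMap ℚ ℝ (1 / (n.factorial : ℚ)) * Real.log b ^ n := by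
  classical
  rw [hlogSeries, NCSeries.mul_apply_replicate, Finset.sum_eq_single 0]
  · simp only [List.replicate_zero, Nat.sub_zero]
    rw [hlogReg_nil hσ hb, one_mul, Shuffle.expLetter_replicate]
  · intro k hk hk0
    obtain ⟨k', rfl⟩ := Nat.exists_eq_succ_of_ne_zero hk0
    rw [hlogReg_replicate_succ, zero_mul]
  · intro h; simp at h

/-- `S_{ε,b} · exp(z log ε) → L(b)` coefficientwise as `ε → 0⁺`. [cite: BrownENS2009, §5.1 Prop. 5.1] -/
theorem tendsto_transport_mul_expLetter (W : List α) {b : ℝ} (hb : b ∈ Ioo (0 : ℝ) 1) :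
    Tendsto (fun ε => (transportSeries (pden σ) ε b * Shuffle.expLetter z (Real.log ε)) W)
      (𝓝[>] 0) (𝓝 (hlogSeries σ z b W)) := by
  classical
  have hlim : Tendsto (fun ε => ∑ p ∈ NCSeries.splits W,
      Shuffle.pair (fun u => iterInt (pden σ) u ε b) (Shuffle.regEnd z p.1) *
        Shuffle.expLetter z (Real.log b) p.2) (𝓝[>] 0) (𝓝 (hlogSeries σ z b W)) := by
    rw [hlogSeries, NCSeries.mul_apply]
    exact tendsto_finsetSum _ fun p _ => (tendsto_pair_regEnd hz hσz p.1 hb).mul_const _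
  refine hlim.congr' ?_
  filter_upwards [Ioo_mem_nhdsGT hb.1] with ε hε
  have hε' : ε ∈ Ioo (0 : ℝ) 1 := ⟨hε.1, hε.2.trans hb.2⟩
  have hT : transportSeries (pden σ) ε b =
      (show NCSeries α ℝ from
        fun U => Shuffle.pair (fun u => iterInt (pden σ) u ε b) (Shuffle.regEnd z U)) *
        Shuffle.expLetter z (Real.log b - Real.log ε) := by
    funext U; exact iterInt_eq_pair_regEnd_mul_expLetter hz hσz U hε' hb
  rw [hT, mul_assoc, Shuffle.expLetter_mul_expLetter, sub_add_cancel, NCSeries.mul_apply]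

/-- **`L(b)` is group-like**: `L(b)_∅ = 1` and `L(b)_u L(b)_v = Σ_{w ∈ u ш v} L(b)_w` for ALL
words — the shuffle relations of the fully regularised hyperlogarithms [Brown 2009, (5.5) and
§5.1 after it]. [cite: BrownENS2009, §5.1 eq. (5.5)] -/
theorem isGroupLike_hlogSeries {b : ℝ} (hb : b ∈ Ioo (0 : ℝ) 1) :
    NCSeries.IsGroupLike (hlogSeries σ z b) := by
  have hG : ∀ ε ∈ Ioo (0 : ℝ) b, NCSeries.IsGroupLike
      (transportSeries (pden σ) ε b * Shuffle.expLetter z (Real.log ε)) := fun ε hε =>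
    (isGroupLike_transportSeries KZ3.isOpen_Ioo01 KZ3.ordConnected_Ioo01
      (continuousOn_pden (adm_of_zero_letter σ hz hσz)) ⟨hε.1, hε.2.trans hb.2⟩ hb).mul
      (Shuffle.isGroupLike_expLetter z _)
  refine ⟨?_, fun u v => ?_⟩
  · refine tendsto_nhds_unique (tendsto_transport_mul_expLetter hz hσz [] hb) ?_
    refine (tendsto_const_nhds (x := (1 : ℝ))).congr' ?_
    filter_upwards [Ioo_mem_nhdsGT hb.1] with ε hε
    exact ((hG ε hε).1).symm
  · have h1 := (tendsto_transport_mul_expLetter hz hσz u hb).mul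
      (tendsto_transport_mul_expLetter hz hσz v hb)
    have h2 : Tendsto (fun ε => ((MZV.shuffleWord u v).map
        (transportSeries (pden σ) ε b * Shuffle.expLetter z (Real.log ε))).sum) (𝓝[>] 0)
        (𝓝 ((MZV.shuffleWord u v).map (hlogSeries σ z b)).sum) :=
      tendsto_list_sum _ fun w _ => tendsto_transport_mul_expLetter hz hσz w hb
    refine tendsto_nhds_unique h1 (h2.congr' ?_)
    filter_upwards [Ioo_mem_nhdsGT hb.1] with ε hε
    exact ((hG ε hε).2 u v).symm

/-- The shuffle relations of `L(b)`, spelled out. [cite: BrownENS2009, §5.1 eq. (5.5)] -/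
theorem hlogSeries_mul {b : ℝ} (hb : b ∈ Ioo (0 : ℝ) 1) (u v : List α) :
    hlogSeries σ z b u * hlogSeries σ z b v = ((MZV.shuffleWord u v).map (hlogSeries σ z b)).sum :=
  (isGroupLike_hlogSeries hz hσz hb).2 u v

/-- `f₀(b) → 1` as `b → 0⁺`: `L^reg_W(b) → 0` for `W ≠ ∅` [Brown 2009, Prop. 5.1, `f₀(σ₀) = 1`].
[cite: BrownENS2009, §5.1 Prop. 5.1] -/
theorem tendsto_hlogReg_zero {W : List α} (hW : W ≠ []) :
    Tendsto (hlogReg σ z W) (𝓝[>] 0) (𝓝 0) := by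
  unfold hlogReg Shuffle.pair Finsupp.sum
  have h0 : (0 : ℝ) = ∑ u ∈ (Shuffle.regEnd z W).support, (0 : ℝ) := by simp
  rw [show (fun b => ∑ u ∈ (Shuffle.regEnd z W).support, (Shuffle.regEnd z W) u • hlog σ u b) =
    fun b => ∑ u ∈ (Shuffle.regEnd z W).support, (Shuffle.regEnd z W) u • hlog σ u b from rfl, h0]
  refine tendsto_finsetSum _ fun u hu => ?_
  have hne : u ≠ [] := by
    intro h
    have := length_eq_of_mem_support_regEnd z W hu
    rw [h, List.length_nil] at this
    exact hW (List.length_eq_zero_iff.mp this.symm)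
  simpa using (tendsto_hlog_zero (adm_of_zero_letter σ hz hσz) hne
    (isReg_of_mem_support_regEnd hz hσz W hu)).const_smul ((Shuffle.regEnd z W) u)

/-- **Chen's identity for the full series** (flat-section property `L(b') = S_{b→b'} · L(b)`):
`L(b')_W = Σ_{W = uv} I_u(b,b') L(b)_v` for `b, b' ∈ (0,1)`. [folklore] -/
theorem hlogSeries_chen (W : List α) {b b' : ℝ} (hb : b ∈ Ioo (0 : ℝ) 1) (hb' : b' ∈ Ioo (0 : ℝ) 1) :
    hlogSeries σ z b' W =
      ∑ p ∈ NCSeries.splits W, iterInt (pden σ) p.1 b b' * hlogSeries σ z b p.2 := by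
  classical
  have hlim : Tendsto (fun ε => ∑ p ∈ NCSeries.splits W, iterInt (pden σ) p.1 b b' *
      (transportSeries (pden σ) ε b * Shuffle.expLetter z (Real.log ε)) p.2) (𝓝[>] 0)
      (𝓝 (∑ p ∈ NCSeries.splits W, iterInt (pden σ) p.1 b b' * hlogSeries σ z b p.2)) :=
    tendsto_finsetSum _ fun p _ => (tendsto_transport_mul_expLetter hz hσz p.2 hb).const_mul _
  refine tendsto_nhds_unique (tendsto_transport_mul_expLetter hz hσz W hb') (hlim.congr' ?_)
  filter_upwards [Ioo_mem_nhdsGT (lt_min hb.1 hb'.1)] with ε hε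
  have hε' : ε ∈ Ioo (0 : ℝ) 1 := ⟨hε.1, (hε.2.trans_le (min_le_left _ _)).trans hb.2⟩
  have hchen := transportSeries_chen KZ3.isOpen_Ioo01 KZ3.ordConnected_Ioo01
    (continuousOn_pden (adm_of_zero_letter σ hz hσz)) hε' hb hb'
  -- `(S_{b,b'} · (S_{ε,b} · E))_W = ((S_{b,b'} · S_{ε,b}) · E)_W = (S_{ε,b'} · E)_W`
  have h : (transportSeries (pden σ) ε b' * Shuffle.expLetter z (Real.log ε)) W =
      ((transportSeries (pden σ) b b' * transportSeries (pden σ) ε b) *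
        Shuffle.expLetter z (Real.log ε)) W := by rw [hchen]
  rw [h, mul_assoc, NCSeries.mul_apply]
  rfl

/-- **The differential equation (5.2) for all words**: `∂_b L(b)_{cW} = L(b)_W/|b - σ_c|` on
`(0,1)`, for every letter `c` (including `z`: `∂_b logⁿ⁺¹(b)/(n+1)! = (1/b) logⁿ(b)/n!`) and every
word `W` [Brown 2009, (5.2); §5.1: the extended `L_w` "are solutions to (5.2)"].
[cite: BrownENS2009, §5.1 eq. (5.2)] -/
theorem hasDerivAt_hlogSeries_cons (c : α) (W : List α) {b : ℝ} (hb : b ∈ Ioo (0 : ℝ) 1) :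
    HasDerivAt (fun b' => hlogSeries σ z b' (c :: W)) (pden σ c b * hlogSeries σ z b W) b := by
  classical
  have heq : (fun b' => ∑ p ∈ NCSeries.splits (c :: W),
      iterInt (pden σ) p.1 b b' * hlogSeries σ z b p.2) =ᶠ[𝓝 b] fun b' => hlogSeries σ z b' (c :: W) := by
    filter_upwards [KZ3.isOpen_Ioo01.mem_nhds hb] with b' hb'
    exact (hlogSeries_chen hz hσz (c :: W) hb hb').symm
  refine HasDerivAt.congr_of_eventuallyEq ?_ heq.symm
  have hderiv : ∀ p ∈ NCSeries.splits (c :: W),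
      HasDerivAt (fun b' => iterInt (pden σ) p.1 b b' * hlogSeries σ z b p.2)
        ((match p.1 with
          | [] => 0
          | d :: u => pden σ d b * iterInt (pden σ) u b b) * hlogSeries σ z b p.2) b := by
    intro p _
    refine HasDerivAt.mul_const ?_ _
    rcases p with ⟨u, v⟩
    cases u with
    | nil =>
      show HasDerivAt (fun b' => iterInt (pden σ) [] b b') 0 b
      simp_rw [iterInt_nil]
      exact hasDerivAt_const b 1
    | cons d u =>
      show HasDerivAt (fun b' => iterInt (pden σ) (d :: u) b b') (pden σ d b * iterInt (pden σ) u b b) b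
      exact hasDerivAt_iterInt_cons KZ3.isOpen_Ioo01 KZ3.ordConnected_Ioo01
        (continuousOn_pden (adm_of_zero_letter σ hz hσz)) hb d u hb
  have hsum := HasDerivAt.sum hderiv
  convert hsum using 1
  · ext b'; simp [Finset.sum_apply]
  · rw [NCSeries.sum_splits_cons]
    simp only [zero_mul, zero_add]
    rw [← Finset.add_sum_erase _ _ (NCSeries.nil_self_mem_splits W)]
    simp only [iterInt_nil, mul_one]
    rw [Finset.sum_eq_zero, add_zero]
    intro p hp
    obtain ⟨hne, hp⟩ := Finset.mem_erase.mp hp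
    have hp1 : p.1 ≠ [] := by
      intro h1; apply hne
      rw [NCSeries.mem_splits] at hp
      ext1
      · exact h1
      · simpa [h1] using hp
    simp [iterInt_self_of_ne_nil _ hp1]

/-- `L(b)_∅ = 1`. [folklore] -/
theorem hlogSeries_nil {b : ℝ} (hb : b ∈ Ioo (0 : ℝ) 1) : hlogSeries σ z b [] = 1 :=
  (isGroupLike_hlogSeries hz hσz hb).1

/-- `b ↦ L(b)_W` is continuous on `(0,1)`. [folklore] -/
theorem continuousOn_hlogSeries (W : List α) : ContinuousOn (fun b => hlogSeries σ z b W) (Ioo 0 1) := by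
  cases W with
  | nil =>
    refine (continuousOn_const (c := (1 : ℝ))).congr fun b hb => ?_
    exact hlogSeries_nil hz hσz hb
  | cons c W =>
    exact continuousOn_of_forall_continuousAt fun b hb =>
      (hasDerivAt_hlogSeries_cons hz hσz c W hb).continuousAt

/-- **The integral formula for all words** between interior points:
`L(b)_{cW} - L(a)_{cW} = ∫_a^b L(t)_W dt/|t - σ_c|`, `a, b ∈ (0,1)` [Brown 2009, (5.4), for the
extended family]. [cite: BrownENS2009, §5.1 eq. (5.4)] -/
theorem hlogSeries_cons_sub (c : α) (W : List α) {a b : ℝ} (ha : a ∈ Ioo (0 : ℝ) 1)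
    (hb : b ∈ Ioo (0 : ℝ) 1) :
    hlogSeries σ z b (c :: W) - hlogSeries σ z a (c :: W) =
      ∫ t in a..b, pden σ c t * hlogSeries σ z t W := by
  have hsub : uIcc a b ⊆ Ioo 0 1 := KZ3.ordConnected_Ioo01.uIcc_subset ha hb
  have hcont : ContinuousOn (fun t => pden σ c t * hlogSeries σ z t W) (Ioo 0 1) :=
    (continuousOn_pden (adm_of_zero_letter σ hz hσz) c).mul (continuousOn_hlogSeries hz hσz W)
  rw [intervalIntegral.integral_eq_sub_of_hasDerivAt
    (fun t ht => hasDerivAt_hlogSeries_cons hz hσz c W (hsub ht)) ((hcont.mono hsub).intervalIntegrable)]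

end Regularised

end Hyperlog

end Literature.NumberTheory.Transcendental
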